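import Summits.CriticalPhenomena.PercolationContinuityZ3.Theorems.PercNearOneGluingNoHeavyLowerTailMajorityGluingQCert3Range
import Summits.CriticalPhenomena.PercolationContinuityZ3.Theorems.PercNearOneGluingNoHeavyLowerTailMajorityGluingQCert3Smoke
import Summits.CriticalPhenomena.PercolationContinuityZ3.Theorems.PercNearOneGluingNoHeavyLowerTailMajorityGluingQCertSort2
import HarnessLib

/-!
# Degree-3 certificates checked by SLICES of the smallest index: the evaluator that fits the farm's per-declaration budget (lane prim-rate, constants-miner 1, gen 34; NEXT-g35 item 0)

Support file for the closed crux `NoHeavyLowerTail` (stmt-CriticalPhenomena-4575), majority-gluing line; companion of `…QCert3` / `…QCert3Range`.  A `(6,4)` degree-3 certificate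
below `5/4` has ≈ 3.5·10⁵ contributions, and no single farm declaration can scan them all (measured: ≈ 1.5·10⁵ contribution-steps per declaration; CANDIDATES §GEN-34 R330).
Here every theorem touches ONE SLICE: `Cert3.sliceContribs c i₀` generates — by case analysis on which index of a contribution is the smallest — exactly the contributions whose
sorted key starts with `i₀` (`prodSlice` for row / square entries: «`t = i₀`, both other indices `≥ i₀`» or «one mask index `= i₀`, the rest `≥ i₀`»; `linSlice` for the
`ell2` / `lin3` entries), scanning only the entry lists (≈ 2·10⁴ entries) and producing ≈ 1.4·10⁴ contributions for the largest slice of `QCert.sixFour3` (kernel: ≈ 30 s incl.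
`msort2` + `runsOK`, measured).  `Cert3.checkSlice c i₀ fuel` sorts the slice and scans its runs; `Cert3.evalC_slice_nonneg` is its soundness for the slice's own value.
WHAT REMAINS (NEXT-g35 item 0): the partition identity `Σ_{i₀ < NV} evalC val (c.sliceContribs i₀) = evalC val c.contribs` (each contribution lies in exactly the slice of its smallest
index; verified numerically on `sixFour3` slice by slice in census/g34/cert), after which `Cert3.sound3_of_eval` / `cut_of_eval3_count` apply.  No sorries.
-/

namespace Summit.CriticalPhenomena.PercolationContinuityZ3.Theorems

namespace HubOnly
namespace QCert

/-- The indices in `[lo, N)` selected by `P`. -/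
def suppGe (N lo : ℕ) (P : ℕ → Bool) : List ℕ := (List.range' lo (N - lo)).filter P

/-- **Slice of a product term** `Σ_{p ∈ P₁, q ∈ P₂} g(p,q)·x_p x_q x_t`: the contributions whose smallest index is `i₀` — none if `t < i₀`; all pairs `p, q ≥ i₀` if `t = i₀`;
otherwise `p = i₀ ≤ q` or `q = i₀ < p`. -/
def prodSlice (N i₀ : ℕ) (P₁ P₂ : ℕ → Bool) (t : ℕ) (g : ℕ → ℕ → ℤ) : List (ℕ × ℤ) :=
  if t < i₀ then []
  else if t = i₀ then
    ((suppGe N i₀ P₁).map fun p => (suppGe N i₀ P₂).map fun q => (key3 N p q t, g p q)).flatten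
  else
    (if P₁ i₀ then (suppGe N i₀ P₂).map (fun q => (key3 N i₀ q t, g i₀ q)) else []) ++
    (if P₂ i₀ then (suppGe N (i₀ + 1) P₁).map (fun p => (key3 N p i₀ t, g p i₀)) else [])

/-- **Slice of a linear-form term** `Σ_{i ∈ F} z·x_i x_a x_b`: none if `a < i₀` or `b < i₀`; all `i ≥ i₀` in `F` if `a = i₀` or `b = i₀`; otherwise only `i = i₀` (if in `F`). -/
def linSlice (N i₀ : ℕ) (F : ℕ → Bool) (a b : ℕ) (z : ℤ) : List (ℕ × ℤ) :=
  if a < i₀ ∨ b < i₀ then []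
  else if a = i₀ ∨ b = i₀ then (suppGe N i₀ F).map fun i => (key3 N i a b, z)
  else if F i₀ then [(key3 N i₀ a b, z)] else []

namespace Cert3

variable (c : Cert3)

/-- **The contributions of the certificate whose smallest index is `i₀`** (same signs as `Cert3.contribs`: LHS positive, RHS negative). -/
def sliceContribs (i₀ : ℕ) : List (ℕ × ℤ) :=
  (c.ell2.map fun e =>
      linSlice c.NV i₀ (fun i => i = c.base.D) e.1 e.2.1 ((e.2.2 : ℤ) * c.base.cN) ++
      linSlice c.NV i₀ c.base.tMem e.1 e.2.1 (-((e.2.2 : ℤ) * c.base.cD))).flatten ++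
  (c.lin3.map fun e =>
      if e.1 = 1 then
        linSlice c.NV i₀ (fun i => i = c.base.D) e.2.2.1 e.2.2.2.1 (-(e.2.2.2.2 : ℤ)) ++
        linSlice c.NV i₀ (c.base.margMem e.2.1) e.2.2.1 e.2.2.2.1 (e.2.2.2.2 : ℤ)
      else
        linSlice c.NV i₀ (c.base.eMem (e.2.1 + 1)) e.2.2.1 e.2.2.2.1 (-(e.2.2.2.2 : ℤ)) ++
        linSlice c.NV i₀ (c.base.eMem e.2.1) e.2.2.1 e.2.2.2.1 (e.2.2.2.2 : ℤ)).flatten ++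
  (c.rows.map fun ch => (ch.map fun r =>
      prodSlice c.NV i₀ (tb r.row.m3) (tb r.row.m4) r.t (fun _ _ => -(r.row.n : ℤ)) ++
      prodSlice c.NV i₀ (tb r.row.m1) (tb r.row.m2) r.t (fun _ _ => (r.row.n : ℤ))).flatten).flatten ++
  (c.sqs.map fun ch => (ch.map fun s =>
      prodSlice c.NV i₀ (tb (s.sq.m1 ||| s.sq.m2)) (tb (s.sq.m1 ||| s.sq.m2)) s.t
        (fun p q => -((s.sq.n : ℤ) * s.sq.u p * s.sq.u q))).flatten).flatten

/-- **The slice check:** sort the slice by key (`msort2`) and scan its runs. -/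
def checkSlice (i₀ fuel : ℕ) : Bool := runsOK (msort2 fuel (c.sliceContribs i₀))

/-- The size of a slice (diagnostic). -/
def sliceLen (i₀ : ℕ) : ℕ := (c.sliceContribs i₀).length

/-- **A passing slice evaluates nonnegatively** at every nonnegative valuation of the keys. -/
theorem evalC_slice_nonneg (i₀ fuel : ℕ) (h : c.checkSlice i₀ fuel = true) (val : ℕ → ℝ) (hval : ∀ i, 0 ≤ val i) :
    0 ≤ evalC val (c.sliceContribs i₀) :=
  evalC_nonneg_of_runsOK_msort2 val hval fuel _ h

end Cert3

/-- Smoke test: the slices of the `(3,2)` test certificate `threeTwo3` all pass (slices `0 … 8`; `NV = 9`). -/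
theorem threeTwo3_slices : (List.range 9).all (fun i₀ => threeTwo3.checkSlice i₀ 10) = true := by decide +kernel

end QCert
end HubOnly

end Summit.CriticalPhenomena.PercolationContinuityZ3.Theorems
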